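import Summits.BirchSwinnertonDyer.Rank1Residual.Additive.X4KimLargeImageLevelKRankOne
import Summits.BirchSwinnertonDyer.Rank1Residual.Additive.PlusSymbolIntegrality
import HarnessLib

/-!
# Kim 2025 Thm. 1.1 in analytic rank ONE: the integrality binder DISCHARGED — p17's rank-one
# `∂`-predicates and the level-`k` / TAM / O7 ∩ X4@3 census shapes from the one primary P1 ALONE
# (cell `b2b-bsdres`, team n1011, seat p11, OWNERS row T-a4-LK, file 2; uses p09's T-R18b theorem)

HONEST FRAMING (cell `b2b-bsdres`, run/shared/lean/b2b/bsd-rank1-residual/, verbatim in every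
file): the goal of the cell is to DELETE the COMBINATION-SHAPED residual classes of the
Birch–Swinnerton-Dyer formula for ALL analytic-rank `≤ 1` elliptic curves over `ℚ` — "full BSD
formula for every rank `≤ 1` curve in class `C`" assembled STRICTLY from published theorems — so
that the rank-`≤ 1` remainder becomes exactly the CONSTRUCTION-SHAPED classes, which are TYPED
(missing-input `Prop`s), NOT attempted. This is not "finishing BSD". Team n1011 is a RESEARCH ROUTE;
no claim beyond the stated classes; no label or mark is changed by this file; nothing is booked.
Every theorem below carries `hK25s : Kim2025.thm11_kimShaLength_of_integralPeriod_OPEN` and is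
CONDITIONAL on the unrefereed arXiv:2505.09121v1 (FLAG `Kim2025-preprint`). THEOREMS ONLY (no
definition, no `@[conjecture]`, no named fact); per pair; NOT class theorems.

## What this file does

File 1 (`X4KimLargeImageLevelKRankOne.lean`) derived p17's rank-one `∂`-predicate
`KimRankOnePartialAt W p` — hence `KimRankOneUnitAt`, `KimRankOneLevelTwoAt`, the level-`k` and
TAM shapes, and at `p = 3` `KimThreeRankOnePartial` / `X4SharpThreeKimRankOnePartial` — from P1
MODULO the `Ω⁺_{D.f}`-integrality binder for every datum (FLAG `Kim2025-OmegaE-integrality`).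
p09's T-R18b KERNEL THEOREM `padicValRat_ratPlusSymbol_nonneg_of_irreducible`
(`Additive/PlusSymbolIntegrality.lean`: `p` odd ∧ `E[p]` irreducible ∧ `f` the newform of `E` ⟹
`0 ≤ ord_p [r]⁺_f` for every `r` with `[r]⁺_f ≠ 0`; Drinfeld–Manin made `p`-integral, with the
Galois input = p11's T-R18a `geomTorsion_eq_zero_of_commutator_fixed_of_irreducible`) DISCHARGES that
binder BY NAME (referee-1 ACK-1 T-a4-LK proviso (2): "discharge by NAME (Irr ⇐ Surj), never by
`_holds` of a fact"): the predicates' own first binder `hsurj : ρ̄_{E,p}` onto gives `E[p]`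
irreducible (`hasIrreducibleModPGaloisRep_of_hasSurjectiveModNGaloisRep`), `p ≥ 3` gives `p ≠ 2`.
So: **`KimRankOnePartialAt W p`, `KimRankOneUnitAt W p`, `KimRankOneLevelTwoAt W p` (every `p ≥ 3`)
and `KimThreeRankOnePartial`, `X4SharpThreeKimRankOnePartial` follow from P1 ALONE** — the FLAG
`Kim2025-OmegaE-integrality` is lifted from the rank-one family (it stays on the three `Ω(W)`-shaped
`_OPEN` Props of `LargeImageStructureOPEN`, whose Manin binder is a different statement).

* `kimRankOnePartialAt_of_thm11`, `kimRankOneUnitAt_of_thm11`, `kimRankOneLevelTwoAt_of_thm11`,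
  `kimThreeRankOnePartial_of_thm11`, `x4SharpThreeKimRankOnePartial_of_thm11`;
* datum currency, no integrality binder: `rankOne_sha_val_le_of_thm11_of_levelK'`,
  `rankOne_sha_val_add_tamagawa_le_of_thm11_of_levelK'`,
  `rankOne_card_primaryComponent_eq_one_of_thm11_of_exactLevel'`;
* O7 ∩ X4@3 TAM rows (p17's §4 census shapes with `h3 := x4SharpThreeKimRankOnePartial_of_thm11 hK25s`):
  `X4RankOne.bsdp_three_of_thm11_of_tamagawaDefectGe_of_cert[_of_optimal]` — `BSD(E,3)` on a TAM row
  from P1 ∧ Conj. 1.10's `≥` half ∧ ONE exact-level certificate ∧ `3 ∤ #Ш_an` (+ GZK, modularity).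

INSTRUMENT-SCOPE CAVEAT for rank-one rows at `p = 3` (route (a) R1-17 / candidate prediction
P-TAM3, `cells/n1011/ROUTE-1.md` §18.6; lead R5-27 (c); docstring only — NO kernel statement changes):
[MR04] Mazur–Rubin, Prop. 6.2.6 + Rem. A.5 read at `p = 3` say that on every `surj(3)` row carrying a
Tamagawa-3 prime `ℓ ≠ 3` (`3 ∣ c_ℓ(E)`: split multiplicative `ℓ` with `3 ∣ ord_ℓ(Δ)`, or additive
`ℓ` of type IV / IV*) the level-one shadow of `κ^Kato` lies in `KS(E[3], F_u, 𝒫_j) = 0`; in the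
Kurihara dictionary the LEVEL-ONE instrument is therefore predicted BLIND on such rank-ONE N10/N11/O7
rows — every level-1 Kurihara number `δ̃_n` (`n ∈ 𝒩(𝒫₁)` on `t(E) = 0` rows, `n ∈ 𝒩(𝒫_{e+1})`
when `#E(ℚ₃)[3^∞] = 3^e ≥ 3`) is `≡ 0 (mod 3)` — so a rank-one STRUCTURE certificate (the binder
`hδ : kuriharaNumber D.f (3 ^ k) ℓ ψ ≠ 0` below) can only come from level `k ≥ 2` (`E[9]`) there;
the caveat is SILENT when the Tamagawa 3 sits at `ℓ = 3 = p`. This is consistent with the shapes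
below, not a restriction of them: with Conj. 1.10's `≥` half, `k − 1 ≥ ord₃ #Ш(3) + ord₃ ∏c ≥ 1` on
such rows, and the TAM census shapes of §3 already sit at level `ord₃ ∏c + 1 ≥ 2`. A READING
(EVIDENCE lane: p08's STAGE reports print the level-1 `δ̃ (mod 3)` vector per row), not a theorem
of this file.

References: Kim 2025 [Kim2025RefinedTNC] Thm. 1.1 (PREPRINT); Kim 2026 [Kim2022StructureSelmer]
Thm. 1.9 (6), §1.4.1, Conj. 1.10; Sakamoto 2024 [Sakamoto2024KolyvaginThree] Thm. 1.1; Miller 2011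
[Miller2011LMS] Def. 1.1.
-/

noncomputable section

open scoped Classical MatrixGroups ModularForm

open CongruenceSubgroup WeierstrassCurve Literature.NumberTheory.EllipticCurves
  Literature.NumberTheory.EllipticCurves.ModularForms
  Literature.NumberTheory.EllipticCurves.Rank1Residual
  Literature.NumberTheory.EllipticCurves.Rank1Residual.Typed

namespace Summit.BirchSwinnertonDyer.Rank1Residual.Additive

variable (W : WeierstrassCurve ℚ) [W.IsElliptic] [W.IsGloballyMinimal] (p : ℕ) [hp : Fact p.Prime]

/-! ### §1 P1 ALONE ⟹ p17's rank-one `∂`-predicates -/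

/-- **P1 ⟹ `KimRankOnePartialAt W p` with NO integrality binder** (`p ≥ 3`): the predicate's own
`hsurj` gives `E[p]` irreducible, and p09's T-R18b theorem gives `Ω⁺_{D.f}`-integrality for every
datum; then file 1's `kimRankOnePartialAt_of_thm11_of_integral`. CONDITIONAL on the preprint only.
[claim: Kim2025RefinedTNC, status: under-review] [cite: Kim2025RefinedTNC, Thm. 1.1 ("BSD") (ANNOUNCED, OPEN binder)]
[cite: Kim2022StructureSelmer, Thm. 1.9 (6), §1.4.1 (PDF pp. 7–8)] -/
theorem kimRankOnePartialAt_of_thm11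
    (hK25s : Kim2025.thm11_kimShaLength_of_integralPeriod_OPEN) (hp3 : 3 ≤ p) :
    KimRankOnePartialAt W p := by
  intro hsurj htower hL hr hfin N _ D hc hper hne
  haveI : NeZero p := ⟨hp.out.ne_zero⟩
  have hirr : W.HasIrreducibleModPGaloisRep p :=
    hasIrreducibleModPGaloisRep_of_hasSurjectiveModNGaloisRep W p hsurj
  exact rankOne_shaLength_eq_of_thm11 W p hK25s hp3 htower hL hfin D.isNewformOf
    (fun r hr0 ↦ padicValRat_ratPlusSymbol_nonneg_of_irreducible (by omega) D.isNewformOf hirr r hr0)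
    hne

/-- **P1 ⟹ `KimRankOneUnitAt W p`** (`p ≥ 3`), no integrality binder. CONDITIONAL on the preprint.
[claim: Kim2025RefinedTNC, status: under-review] [cite: Kim2025RefinedTNC, Thm. 1.1 ("BSD") (ANNOUNCED, OPEN binder)] -/
theorem kimRankOneUnitAt_of_thm11
    (hK25s : Kim2025.thm11_kimShaLength_of_integralPeriod_OPEN) (hp3 : 3 ≤ p) :
    KimRankOneUnitAt W p :=
  kimRankOneUnitAt_of_partial W p (kimRankOnePartialAt_of_thm11 W p hK25s hp3)

/-- **P1 ⟹ `KimRankOneLevelTwoAt W p`** (`p ≥ 3`), no integrality binder. CONDITIONAL on the preprint.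
[claim: Kim2025RefinedTNC, status: under-review] [cite: Kim2025RefinedTNC, Thm. 1.1 ("BSD") (ANNOUNCED, OPEN binder)] -/
theorem kimRankOneLevelTwoAt_of_thm11
    (hK25s : Kim2025.thm11_kimShaLength_of_integralPeriod_OPEN) (hp3 : 3 ≤ p) :
    KimRankOneLevelTwoAt W p :=
  kimRankOneLevelTwoAt_of_partial W p (kimRankOnePartialAt_of_thm11 W p hK25s hp3)

/-- **P1 ⟹ `KimThreeRankOnePartial`** (p17's every-curve rank-one `∂`-conjecture at `3`) — P1 ALONE.
CONDITIONAL on the preprint. [claim: Kim2025RefinedTNC, status: under-review]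
[cite: Kim2025RefinedTNC, Thm. 1.1 ("BSD") (ANNOUNCED, OPEN binder)] [cite: Sakamoto2024KolyvaginThree, Thm. 1.1] -/
theorem kimThreeRankOnePartial_of_thm11
    (hK25s : Kim2025.thm11_kimShaLength_of_integralPeriod_OPEN) : KimThreeRankOnePartial :=
  fun W _ _ => kimRankOnePartialAt_of_thm11 W 3 hK25s le_rfl

/-- **P1 ⟹ `X4SharpThreeKimRankOnePartial`** — P1 ALONE. CONDITIONAL on the preprint.
[claim: Kim2025RefinedTNC, status: under-review] [cite: Kim2025RefinedTNC, Thm. 1.1 ("BSD") (ANNOUNCED, OPEN binder)] -/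
theorem x4SharpThreeKimRankOnePartial_of_thm11
    (hK25s : Kim2025.thm11_kimShaLength_of_integralPeriod_OPEN) : X4SharpThreeKimRankOnePartial :=
  fun W _ _ _ => kimRankOnePartialAt_of_thm11 W 3 hK25s le_rfl

/-! ### §2 Datum currency, no integrality binder: the level-`k` and TAM shapes from P1 -/

/-- **P1 ⟹ `ord_p #Ш(E/ℚ)(p) ≤ k − 1`** (datum currency, p17's binders; NO integrality binder) from ONE
Kurihara number non-zero modulo `p^k` at a cyclic Kolyvagin prime of level `k`. CONDITIONAL on the
preprint. [claim: Kim2025RefinedTNC, status: under-review] [cite: Kim2025RefinedTNC, Thm. 1.1 ("BSD") (ANNOUNCED, OPEN binder)] -/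
theorem rankOne_sha_val_le_of_thm11_of_levelK'
    (hK25s : Kim2025.thm11_kimShaLength_of_integralPeriod_OPEN) (hp3 : 3 ≤ p)
    (hsurj : W.HasSurjectiveModNGaloisRep p)
    (htower : ∀ n : ℕ, W.HasSurjectiveModNGaloisRep (p ^ n : ℕ)) (hL : W.entireLFunction 1 = 0)
    (hr : W.analyticRank = 1) (hfin : Finite W.sha)
    {N : ℕ} [NeZero N] (D : ModularParametrizationData W N) (hc : ¬ (p : ℤ) ∣ D.maninConstant)
    (hper : ∃ u : ℚ, ‖(u : ℚ_[p])‖ = 1 ∧ W.realPeriodRat = u * plusPeriod D.f)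
    {k : ℕ} (hk : 1 ≤ k) (ℓ : ℕ) [Fact ℓ.Prime] (hℓ : Kato.IsKolyvaginPrime W p k ℓ)
    (hcyc : Nat.card {P : ((WeierstrassCurve.integralModelInt W).map
        (Int.castRingHom (ZMod ℓ))).toAffine.Point // p • P = 0} ≤ p)
    (ψ : (ℓ' : ℕ) → (ZMod ℓ')ˣ →* Multiplicative (ZMod (p ^ k)))
    (hψ : Function.Surjective (ψ ℓ)) (hδ : kuriharaNumber D.f (p ^ k) ℓ ψ ≠ 0) :
    padicValNat p (Nat.card (AddCommGroup.primaryComponent W.sha p)) ≤ k - 1 :=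
  rankOne_sha_val_le_of_partial_of_levelK W p (kimRankOnePartialAt_of_thm11 W p hK25s hp3) hsurj
    htower hL hr hfin D hc hper hk ℓ hℓ hcyc ψ hψ hδ

/-- **P1 ∧ Conj. 1.10's `≥` half ⟹ `ord_p #Ш(E/ℚ)(p) + ord_p ∏c ≤ k − 1`** (datum currency; NO
integrality binder). CONDITIONAL on the preprint and on Conj. 1.10. [claim: Kim2025RefinedTNC, status: under-review]
[cite: Kim2025RefinedTNC, Thm. 1.1 ("BSD") (ANNOUNCED, OPEN binder)] [cite: Kim2022StructureSelmer, Conj. 1.10 (PDF p. 8)] -/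
theorem rankOne_sha_val_add_tamagawa_le_of_thm11_of_levelK'
    (hK25s : Kim2025.thm11_kimShaLength_of_integralPeriod_OPEN) (hp3 : 3 ≤ p)
    (hsurj : W.HasSurjectiveModNGaloisRep p)
    (htower : ∀ n : ℕ, W.HasSurjectiveModNGaloisRep (p ^ n : ℕ)) (hL : W.entireLFunction 1 = 0)
    (hr : W.analyticRank = 1) (hfin : Finite W.sha)
    {N : ℕ} [NeZero N] (D : ModularParametrizationData W N) (hc : ¬ (p : ℤ) ∣ D.maninConstant)
    (hper : ∃ u : ℚ, ‖(u : ℚ_[p])‖ = 1 ∧ W.realPeriodRat = u * plusPeriod D.f)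
    (hGe : X4.KimTamagawaDefectGeAt W p D.f)
    {k : ℕ} (hk : 1 ≤ k) (ℓ : ℕ) [Fact ℓ.Prime] (hℓ : Kato.IsKolyvaginPrime W p k ℓ)
    (hcyc : Nat.card {P : ((WeierstrassCurve.integralModelInt W).map
        (Int.castRingHom (ZMod ℓ))).toAffine.Point // p • P = 0} ≤ p)
    (ψ : (ℓ' : ℕ) → (ZMod ℓ')ˣ →* Multiplicative (ZMod (p ^ k)))
    (hψ : Function.Surjective (ψ ℓ)) (hδ : kuriharaNumber D.f (p ^ k) ℓ ψ ≠ 0) :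
    padicValNat p (Nat.card (AddCommGroup.primaryComponent W.sha p)) +
      padicValNat p W.tamagawaProduct ≤ k - 1 :=
  padicValNat_primaryComponent_add_le_of_partial_of_tamagawaDefectGe W p
    (kimRankOnePartialAt_of_thm11 W p hK25s hp3) hsurj htower hL hr hfin D hc hper hGe hk ℓ hℓ hcyc ψ
    hψ hδ

/-- **P1 ∧ Conj. 1.10's `≥` half ∧ ONE exact-level certificate ⟹ `#Ш(E/ℚ)(p) = 1`** (datum currency;
NO integrality binder). CONDITIONAL on the preprint and on Conj. 1.10. [claim: Kim2025RefinedTNC, status: under-review]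
[cite: Kim2025RefinedTNC, Thm. 1.1 ("BSD") (ANNOUNCED, OPEN binder)] [cite: Kim2022StructureSelmer, Conj. 1.10 (PDF p. 8)] -/
theorem rankOne_card_primaryComponent_eq_one_of_thm11_of_exactLevel'
    (hK25s : Kim2025.thm11_kimShaLength_of_integralPeriod_OPEN) (hp3 : 3 ≤ p)
    (hsurj : W.HasSurjectiveModNGaloisRep p)
    (htower : ∀ n : ℕ, W.HasSurjectiveModNGaloisRep (p ^ n : ℕ)) (hL : W.entireLFunction 1 = 0)
    (hr : W.analyticRank = 1) (hfin : Finite W.sha)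
    {N : ℕ} [NeZero N] (D : ModularParametrizationData W N) (hc : ¬ (p : ℤ) ∣ D.maninConstant)
    (hper : ∃ u : ℚ, ‖(u : ℚ_[p])‖ = 1 ∧ W.realPeriodRat = u * plusPeriod D.f)
    (hGe : X4.KimTamagawaDefectGeAt W p D.f)
    (ℓ : ℕ) [Fact ℓ.Prime] (hℓ : Kato.IsKolyvaginPrime W p (padicValNat p W.tamagawaProduct + 1) ℓ)
    (hcyc : Nat.card {P : ((WeierstrassCurve.integralModelInt W).map
        (Int.castRingHom (ZMod ℓ))).toAffine.Point // p • P = 0} ≤ p)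
    (ψ : (ℓ' : ℕ) → (ZMod ℓ')ˣ →* Multiplicative (ZMod (p ^ (padicValNat p W.tamagawaProduct + 1))))
    (hψ : Function.Surjective (ψ ℓ))
    (hδ : kuriharaNumber D.f (p ^ (padicValNat p W.tamagawaProduct + 1)) ℓ ψ ≠ 0) :
    Nat.card (AddCommGroup.primaryComponent W.sha p) = 1 :=
  card_primaryComponent_eq_one_of_partial_of_tamagawaDefectGe W p
    (kimRankOnePartialAt_of_thm11 W p hK25s hp3) hsurj htower hL hr hfin D hc hper hGe ℓ hℓ hcyc ψ hψ hδ

/-! ### §3 O7 ∩ X4 at `p = 3`, TAM rows: p17's census shapes MODULO P1 (no team conjecture left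
except Conj. 1.10's `≥` half) -/

/-- **O7 ∩ X4@3, TAM row, exact-level certificate, MODULO P1**: `ClassX4 W 3` ∧ `r_an = 1`, surj(3) +
tower certificate, datum `D` (`3 ∤ c_D`, period transfer), `v := ord₃ ∏c`, ONE Kurihara number
`δ̃_ℓ ≢ 0 (mod 3^{v+1})` at a cyclic `ℓ ∈ 𝒫_{v+1}(E,3)`, `#Ш_an = q` a `3`-unit ⟹ `BSD(E,3)` — modulo
P1 (`hK25s`) and Conj. 1.10's `≥` half (`hGe`) only (p17's
`X4RankOne.bsdp_three_of_partial_of_tamagawaDefectGe_of_cert` with `h3 := x4SharpThreeKimRankOnePartial_of_thm11 hK25s`).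
Per pair; NOT a class theorem; nothing booked. [claim: Kim2025RefinedTNC, status: under-review]
[cite: Kim2025RefinedTNC, Thm. 1.1 ("BSD") (ANNOUNCED, OPEN binder)] [cite: Kim2022StructureSelmer, Thm. 1.9 (6), Conj. 1.10 (PDF p. 8)]
[cite: Miller2011LMS, Def. 1.1] -/
theorem X4RankOne.bsdp_three_of_thm11_of_tamagawaDefectGe_of_cert
    (hK25s : Kim2025.thm11_kimShaLength_of_integralPeriod_OPEN)
    (hGZK : rank_eq_analyticRank_of_analyticRank_le_one) (hmod : hasEntireLFunction_rat)
    (hX : ClassX4 W 3) (hsurj : Surj W 3)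
    (hcert : (∃ q : ℕ, q.Prime ∧ q ≠ 3 ∧ padicValRat q W.j < 0 ∧ ¬ (3 : ℤ) ∣ padicValRat q W.j) ∨
      W.HasSurjectiveModNGaloisRep 9)
    (hr : W.analyticRank = 1) {q : ℚ} (hq : shaAn W = (q : ℂ)) (hv : padicValRat 3 q = 0)
    {N : ℕ} [NeZero N] (D : ModularParametrizationData W N) (hc : ¬ (3 : ℤ) ∣ D.maninConstant)
    (hper : ∃ u : ℚ, ‖(u : ℚ_[3])‖ = 1 ∧ W.realPeriodRat = u * plusPeriod D.f)
    (hGe : X4.KimTamagawaDefectGeAt W 3 D.f)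
    (ℓ : ℕ) [Fact ℓ.Prime] (hℓ : Kato.IsKolyvaginPrime W 3 (padicValNat 3 W.tamagawaProduct + 1) ℓ)
    (hcyc : Nat.card {P : ((WeierstrassCurve.integralModelInt W).map
        (Int.castRingHom (ZMod ℓ))).toAffine.Point // 3 • P = 0} ≤ 3)
    (ψ : (ℓ' : ℕ) → (ZMod ℓ')ˣ →* Multiplicative (ZMod (3 ^ (padicValNat 3 W.tamagawaProduct + 1))))
    (hψ : Function.Surjective (ψ ℓ))
    (hδ : kuriharaNumber D.f (3 ^ (padicValNat 3 W.tamagawaProduct + 1)) ℓ ψ ≠ 0) : BSDp W 3 :=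
  X4RankOne.bsdp_three_of_partial_of_tamagawaDefectGe_of_cert W
    (x4SharpThreeKimRankOnePartial_of_thm11 hK25s) hGZK hmod hX hsurj hcert hr hq hv D hc hper hGe ℓ
    hℓ hcyc ψ hψ hδ

/-- **O7 ∩ X4@3, TAM row, exact-level certificate, OPTIMAL datum, MODULO P1** (period binder
discharged by `X4.periodTransfer_of_optimal`; `hopt` and `3 ∤ c_D` explicit). Per pair; nothing booked.
[claim: Kim2025RefinedTNC, status: under-review] [cite: Kim2025RefinedTNC, Thm. 1.1 ("BSD") (ANNOUNCED, OPEN binder)]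
[cite: Kim2022StructureSelmer, Thm. 1.9 (6), Conj. 1.10 (PDF p. 8)] [cite: Miller2011LMS, Def. 1.1] -/
theorem X4RankOne.bsdp_three_of_thm11_of_tamagawaDefectGe_of_cert_of_optimal
    (hK25s : Kim2025.thm11_kimShaLength_of_integralPeriod_OPEN)
    (hGZK : rank_eq_analyticRank_of_analyticRank_le_one) (hmod : hasEntireLFunction_rat)
    (hX : ClassX4 W 3) (hsurj : Surj W 3)
    (hcert : (∃ q : ℕ, q.Prime ∧ q ≠ 3 ∧ padicValRat q W.j < 0 ∧ ¬ (3 : ℤ) ∣ padicValRat q W.j) ∨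
      W.HasSurjectiveModNGaloisRep 9)
    (hr : W.analyticRank = 1) {q : ℚ} (hq : shaAn W = (q : ℂ)) (hv : padicValRat 3 q = 0)
    {N : ℕ} [NeZero N] (D : ModularParametrizationData W N)
    (hopt : ∀ z ∈ D.L.lattice, ∃ w ∈ periodLattice D.f, z = D.c * w)
    (hc : ¬ (3 : ℤ) ∣ D.maninConstant) (hGe : X4.KimTamagawaDefectGeAt W 3 D.f)
    (ℓ : ℕ) [Fact ℓ.Prime] (hℓ : Kato.IsKolyvaginPrime W 3 (padicValNat 3 W.tamagawaProduct + 1) ℓ)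
    (hcyc : Nat.card {P : ((WeierstrassCurve.integralModelInt W).map
        (Int.castRingHom (ZMod ℓ))).toAffine.Point // 3 • P = 0} ≤ 3)
    (ψ : (ℓ' : ℕ) → (ZMod ℓ')ˣ →* Multiplicative (ZMod (3 ^ (padicValNat 3 W.tamagawaProduct + 1))))
    (hψ : Function.Surjective (ψ ℓ))
    (hδ : kuriharaNumber D.f (3 ^ (padicValNat 3 W.tamagawaProduct + 1)) ℓ ψ ≠ 0) : BSDp W 3 :=
  X4RankOne.bsdp_three_of_partial_of_tamagawaDefectGe_of_cert_of_optimal W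
    (x4SharpThreeKimRankOnePartial_of_thm11 hK25s) hGZK hmod hX hsurj hcert hr hq hv D hopt hc hGe ℓ
    hℓ hcyc ψ hψ hδ

end Summit.BirchSwinnertonDyer.Rank1Residual.Additive

end
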